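import Mathlib
import Summits.Ventures.PercRepro2.A3PendantFreeMarks

/-!
# The fibres of `C₁ = C(a₁)`: every mark mass through the deleted-graph probabilities `g_x`
(blind cell PercRepro2, night-1 g31; proofs/NIGHT1-G31.md §3″; the assembly is A3PendantFreeRoot.lean)

On the fibres of the `a₁`-exploration on `Q = {a₁ ↮ a₂}` the fibre is `{C(a₁) = W} ∩ Q`
(`fibre_root_eq`), `P(fibre W, x ∈ C₁) = 1[x ∈ W] m_W` (`prob_fibre_root_left`) and — the tower identity
`prob_clusterIn_inter_eq_expect` at the singleton family `{W}` — `P(fibre W, x ∈ C₂) = g_x(W) m_W` with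
`g_x = delClusterProb p ends a₂ {T | x ∈ T}` (`prob_fibre_root_right`).  Hence `Ssig_x = (1_{x∈·} − g_x) m_W`,
`Su_x = (1_{x∈·} + g_x) m_W`, `SFg(γ) = (γ − 2 g_o) m_W` (a non-null fibre has world sign `1`,
`s3_eq_one_of_mW_root_ne_zero`), the ratio term is `(1_{b∈·} − g_b)(γ − 2 g_o) m_W` (`term_root`), and every
sum `∑_W F(W) m_W` is the expectation `E[1_Q · F(C₁)]` (`sum_mW_root_mul`, from HMFLeaf's
`sum_prob_clusterEvent_inter_mul`).  Standard axioms.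
-/

namespace Summit.Ventures.PercRepro2

open UnionCluster CovForm PendantRoot PendantO

namespace CovForm

namespace A3Fibre

section RootFibres

variable {V : Type*} {E : Type*} [Fintype V] [DecidableEq V] [Fintype E] [DecidableEq E]
  {R : Type*} [Field R] [LinearOrder R] [IsStrictOrderedRing R]

omit [Fintype V] [DecidableEq V] [Fintype E] [DecidableEq E] in
/-- The fibre of `a₁` at `W` is `{C(a₁) = W} ∩ {a₁ ↮ a₂}`. -/
lemma fibre_root_eq (ends : E → Sym2 V) (a₁ a₂ : V) (W : Finset V) :
    fibre ends a₁ a₂ a₁ W = clusterInEvent ends a₁ {(↑W : Set V)} ∩ (connEvent ends a₁ a₂)ᶜ := by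
  ext ω
  simp only [fibre, Set.mem_inter_iff, mem_avoidAll, Finset.mem_singleton, forall_eq,
    mem_clusterEvent, mem_clusterInEvent, Set.mem_singleton_iff, Set.mem_compl_iff, mem_connEvent]
  constructor
  · rintro ⟨h1, h2⟩
    exact ⟨h2, fun h => h1 (conn_symm h)⟩
  · rintro ⟨h1, h2⟩
    exact ⟨fun h => h2 (conn_symm h), h1⟩

omit [Fintype V] [Fintype E] [DecidableEq E] in
/-- On the fibre of `a₁` at `W`, `{x ∈ C₁}` is the fibre if `x ∈ W` and empty otherwise. -/
lemma fibre_root_inter_left (ends : E → Sym2 V) (a₁ a₂ x : V) (W : Finset V) :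
    fibre ends a₁ a₂ a₁ W ∩ connEvent ends a₁ x =
      if x ∈ W then fibre ends a₁ a₂ a₁ W else ∅ := by
  have h := fibre_inter_conn_a3 ends a₁ a₂ a₁ x W Set.univ
  rw [Set.inter_univ, Set.inter_univ, connEvent_comm] at h
  exact h

omit [Fintype V] [LinearOrder R] [IsStrictOrderedRing R] in
/-- `P(fibre W ∩ {x ∈ C₁}) = 1[x ∈ W] m_W`. -/
lemma prob_fibre_root_left (p : E → R) (ends : E → Sym2 V) (a₁ a₂ x : V) (W : Finset V) :
    prob p (fibre ends a₁ a₂ a₁ W ∩ connEvent ends a₁ x) =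
      (if x ∈ W then 1 else 0) * mW p ends a₁ a₂ a₁ W := by
  rw [fibre_root_inter_left]
  unfold mW
  split_ifs <;> simp

omit [Fintype V] [DecidableEq V] [LinearOrder R] [IsStrictOrderedRing R] in
/-- The integrand of the tower identity at a singleton family. -/
lemma root_integrand_eq (p : E → R) (ends : E → Sym2 V) (a₁ a₂ x : V) (W : Finset V)
    (ω : Config E) :
    ({(↑W : Set V)} : Set (Set V)).indicator (1 : Set V → R) (cluster ends ω a₁) *
        delClusterProb p ends a₂ {T : Set V | x ∈ T} (cluster ends ω a₁) *
        ((connEvent ends a₁ a₂)ᶜ).indicator (1 : Config E → R) ω =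
      delClusterProb p ends a₂ {T : Set V | x ∈ T} (↑W : Set V) *
        (clusterInEvent ends a₁ {(↑W : Set V)} ∩ (connEvent ends a₁ a₂)ᶜ).indicator
          (1 : Config E → R) ω := by
  by_cases h : cluster ends ω a₁ = (↑W : Set V)
  · rw [h]
    by_cases hQ : ω ∈ (connEvent ends a₁ a₂)ᶜ
    · rw [Set.indicator_of_mem (Set.mem_singleton _), Set.indicator_of_mem hQ,
        Set.indicator_of_mem (show ω ∈ clusterInEvent ends a₁ {(↑W : Set V)} ∩ (connEvent ends a₁ a₂)ᶜ
          from ⟨by simp [clusterInEvent, h], hQ⟩)]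
      simp only [Pi.one_apply]
      ring
    · rw [Set.indicator_of_notMem hQ, Set.indicator_of_notMem
        (show ω ∉ clusterInEvent ends a₁ {(↑W : Set V)} ∩ (connEvent ends a₁ a₂)ᶜ from fun hh => hQ hh.2)]
      ring
  · rw [Set.indicator_of_notMem (by simpa using h), Set.indicator_of_notMem
      (show ω ∉ clusterInEvent ends a₁ {(↑W : Set V)} ∩ (connEvent ends a₁ a₂)ᶜ from
        fun hh => h (by simpa [clusterInEvent] using hh.1))]
    ring

omit [DecidableEq V] [LinearOrder R] [IsStrictOrderedRing R] in
/-- **`P(fibre W ∩ {x ∈ C₂}) = g_x(W) · m_W`** with `g_x = delClusterProb p ends a₂ {T | x ∈ T}`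
(the tower identity over the revealed cluster of `a₁`). -/
lemma prob_fibre_root_right (p : E → R) (ends : E → Sym2 V) (a₁ a₂ x : V) (W : Finset V) :
    prob p (fibre ends a₁ a₂ a₁ W ∩ connEvent ends a₂ x) =
      delClusterProb p ends a₂ {T : Set V | x ∈ T} (↑W : Set V) * mW p ends a₁ a₂ a₁ W := by
  have e : fibre ends a₁ a₂ a₁ W ∩ connEvent ends a₂ x =
      clusterInEvent ends a₁ {(↑W : Set V)} ∩ clusterInEvent ends a₂ {T : Set V | x ∈ T} ∩
        (connEvent ends a₁ a₂)ᶜ := by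
    rw [fibre_root_eq, connEvent_eq_clusterInEvent ends a₂ x]
    ext ω
    simp only [Set.mem_inter_iff, Set.mem_compl_iff]
    tauto
  rw [e, prob_clusterIn_inter_eq_expect]
  unfold mW
  rw [fibre_root_eq, prob_eq_expect_indicator]
  simp only [expect]
  rw [Finset.mul_sum]
  refine Finset.sum_congr rfl fun ω _ => ?_
  rw [root_integrand_eq]
  ring

omit [Fintype V] [LinearOrder R] [IsStrictOrderedRing R] in
/-- `P(fibre W ∩ {x ∈ C₁}) = 1_{x ∈ ·}(W) · m_W` (the indicator written on the set `↑W`). -/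
lemma prob_fibre_root_left' (p : E → R) (ends : E → Sym2 V) (a₁ a₂ x : V) (W : Finset V) :
    prob p (fibre ends a₁ a₂ a₁ W ∩ connEvent ends a₁ x) =
      ({T : Set V | x ∈ T} : Set (Set V)).indicator (1 : Set V → R) (↑W : Set V) *
        mW p ends a₁ a₂ a₁ W := by
  rw [prob_fibre_root_left]
  congr 1
  by_cases hx : x ∈ W
  · rw [if_pos hx, Set.indicator_of_mem (by simpa using hx)]; rfl
  · rw [if_neg hx, Set.indicator_of_notMem (by simpa using hx)]

omit [LinearOrder R] [IsStrictOrderedRing R] in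
/-- `Ssig_x` on the fibres of `a₁`: `(1_{x∈·} − g_x) · m_W`. -/
lemma Ssig_root (p : E → R) (ends : E → Sym2 V) (a₁ a₂ x : V) (W : Finset V) :
    Ssig p ends a₁ a₂ a₁ x W =
      (({T : Set V | x ∈ T} : Set (Set V)).indicator (1 : Set V → R) (↑W : Set V) -
        delClusterProb p ends a₂ {T : Set V | x ∈ T} (↑W : Set V)) * mW p ends a₁ a₂ a₁ W := by
  unfold Ssig
  rw [prob_fibre_root_left', prob_fibre_root_right]
  ring

omit [LinearOrder R] [IsStrictOrderedRing R] in
/-- `Su_x` on the fibres of `a₁`: `(1_{x∈·} + g_x) · m_W`. -/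
lemma Su_root (p : E → R) (ends : E → Sym2 V) (a₁ a₂ x : V) (W : Finset V) :
    Su p ends a₁ a₂ a₁ x W =
      (({T : Set V | x ∈ T} : Set (Set V)).indicator (1 : Set V → R) (↑W : Set V) +
        delClusterProb p ends a₂ {T : Set V | x ∈ T} (↑W : Set V)) * mW p ends a₁ a₂ a₁ W := by
  unfold Su
  rw [prob_fibre_root_left', prob_fibre_root_right]
  ring

omit [Fintype V] [LinearOrder R] [IsStrictOrderedRing R] in
/-- A non-null fibre of `a₁` contains `a₁` and not `a₂`: its world sign is `1`. -/
lemma s3_eq_one_of_mW_root_ne_zero (p : E → R) (ends : E → Sym2 V) (a₁ a₂ : V) (W : Finset V)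
    (h : mW p ends a₁ a₂ a₁ W ≠ 0) : (s3 a₁ a₂ W : R) = 1 := by
  have h₁ : a₁ ∈ W := by
    by_contra h₁
    exact h (mW_eq_zero_of_notMem_self p ends a₁ a₂ a₁ h₁)
  have h₂ : a₂ ∉ W := by
    intro h₂
    exact h (mW_eq_zero_of_mem_mem p ends a₁ a₂ a₁ h₁ h₂)
  unfold s3
  simp [h₁]

omit [LinearOrder R] [IsStrictOrderedRing R] in
/-- `SFg` on the fibres of `a₁`: `(γ − 2 g_o) · m_W`. -/
lemma SFg_root (p : E → R) (ends : E → Sym2 V) (o a₁ a₂ : V) (γ : R) (W : Finset V) :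
    RootEdge.SFg p ends o a₁ a₂ a₁ γ W =
      (γ - 2 * delClusterProb p ends a₂ {T : Set V | o ∈ T} (↑W : Set V)) * mW p ends a₁ a₂ a₁ W := by
  unfold RootEdge.SFg
  rw [Ssig_root, Su_root]
  by_cases hm : mW p ends a₁ a₂ a₁ W = 0
  · rw [hm]; ring
  · rw [s3_eq_one_of_mW_root_ne_zero p ends a₁ a₂ W hm]
    ring

omit [LinearOrder R] [IsStrictOrderedRing R] in
/-- The ratio term on the fibres of `a₁`. -/
lemma term_root (p : E → R) (ends : E → Sym2 V) (o a₁ a₂ b : V) (γ : R) (W : Finset V) :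
    Ssig p ends a₁ a₂ a₁ b W * RootEdge.SFg p ends o a₁ a₂ a₁ γ W / mW p ends a₁ a₂ a₁ W =
      (({T : Set V | b ∈ T} : Set (Set V)).indicator (1 : Set V → R) (↑W : Set V) -
          delClusterProb p ends a₂ {T : Set V | b ∈ T} (↑W : Set V)) *
        (γ - 2 * delClusterProb p ends a₂ {T : Set V | o ∈ T} (↑W : Set V)) * mW p ends a₁ a₂ a₁ W := by
  rw [Ssig_root, SFg_root]
  by_cases hm : mW p ends a₁ a₂ a₁ W = 0
  · rw [hm]; ring
  · field_simp

omit [Fintype V] [DecidableEq V] [LinearOrder R] [IsStrictOrderedRing R] in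
/-- `m_W = P(C(a₁) = W ∩ Q)` in the order of `sum_prob_clusterEvent_inter_mul`. -/
lemma mW_root_eq (p : E → R) (ends : E → Sym2 V) (a₁ a₂ : V) (W : Finset V) :
    mW p ends a₁ a₂ a₁ W = prob p (clusterEvent ends a₁ (↑W : Set V) ∩ avoidAll ends a₂ {a₁}) := by
  unfold mW fibre
  rw [Set.inter_comm]

omit [DecidableEq V] [LinearOrder R] [IsStrictOrderedRing R] in
/-- **The sums over the fibres of `a₁` are expectations over the revealed cluster.** -/
lemma sum_mW_root_mul (p : E → R) (ends : E → Sym2 V) (a₁ a₂ : V) (F : Set V → R) :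
    ∑ W : Finset V, F (↑W : Set V) * mW p ends a₁ a₂ a₁ W =
      expect p (fun ω => (avoidAll ends a₂ {a₁}).indicator 1 ω * F (cluster ends ω a₁)) := by
  rw [← HMFPendantRoot.sum_prob_clusterEvent_inter_mul p ends a₁ (avoidAll ends a₂ {a₁}) F]
  refine Finset.sum_congr rfl fun W _ => ?_
  rw [mW_root_eq, mul_comm]

end RootFibres

end A3Fibre

end CovForm

end Summit.Ventures.PercRepro2
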